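import Summits.CriticalPhenomena.Ising3D.IsingColumnFaceL11CensusRadiiCore

/-!
# The catalogue census of §7.3 as kernel facts, VI-b: the covering-radius machine, `TRG` generator
(cell `pub-ising3x`, seat recog-1; paper §1.6 / §7.3)

HONEST FRAMING: lottery ticket; floor = tightest certified 3D Ising CFT bounds; no exact-solution
claim without a proof. Island framing: certified exclusion region at stated derivative order and
assumptions; not a determination of the 3D Ising critical exponents beyond that.

The `TRG` half of `IsingColumnFaceL11CensusRadiiCore.lean` (see its header for the design): outward natural-
number enclosures `trgEnclN` of the 6 432 monomials `u·π^{a/2}·Γ_g^b·L^s` from the landed certified rational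
enclosures `trgGEncl` (`ExclusionSentencesTrgGamma`), `trgEnclN_sound`; the window generator `trgWin` (in
units `trgU = 10¹⁵·lcm(1, …, 32)`: for each monomial, `q` in the range of the segment and `p ∈ [1, 32]` in the
range of the window, all range arithmetic in `ℕ`) with **`trgWin_sound`** (every generated enclosure contains
`trgU · v` for a member `v` of `trgFullFamily 17 32`; nothing is claimed about completeness); the window check
`trgCover` (`= zgapsLE g x (msortN (trgWin x hi)) hi`) and its meaning `trgCover_part`; the constants of part
VIII (`trgG`, `trgHole{A,B,X,Y}`). Kernel evaluations: `…CensusRadiiTrg{A,B,C,D}.lean`; theorems: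
`…CensusRadiiTrg.lean`. Pure arithmetic; no certificate, no datum, no σ–ε axiom; nothing is recognised.
Python twin: recog-1 gen 52 `twin_radii.py`.
lottery ticket; floor = tightest certified 3D Ising CFT bounds; no exact-solution claim without a proof.
-/

namespace Summit.CriticalPhenomena.Ising3D
namespace ColumnFaceL11
open Set Literature.MathematicalPhysics.QuantumFieldTheory.ConformalBootstrap3D

/-! ### `TRG`: natural-number enclosures of the monomials, window candidates -/

/-- `lcm(1, …, 32)`. [folklore] -/
def lcm32 : ℕ := 144403552893600

/-- The unit of the `TRG` machine: `10¹⁵ · lcm(1, …, 32)`. [folklore] -/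
def trgU : ℕ := 10 ^ 15 * lcm32

/-- `q ∣ lcm(1, …, 32)` for `q ∈ [1, 32]`. [folklore] -/
theorem dvd_lcm32 {q : ℕ} (h1 : 1 ≤ q) (h2 : q ≤ 32) : q ∣ lcm32 := by
  unfold lcm32
  interval_cases q <;> norm_num

/-- Outward natural-number enclosure (numerators over `10¹⁵`) of the monomial `u·π^{a/2}·Γ_g^b·L^s` from the
landed certified rational enclosure `trgGEncl` (the numerators of the census machine's `trgEnclR`). [folklore] -/
def trgEnclN (u : ℕ) (a : ℤ) (g : ℕ) (b : ℤ) (L : ℕ) (s : ℤ) : ℕ × ℕ :=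
  ((⌊(trgGEncl u a g b L s).1 * 10 ^ 15⌋).toNat, (⌈(trgGEncl u a g b L s).2 * 10 ^ 15⌉).toNat)

/-- Soundness of `trgEnclN`: `M₁ ≤ 10¹⁵·(u·π^{a/2}·Γ_g^b·L^s) ≤ M₂`. [folklore] -/
theorem trgEnclN_sound (u : ℕ) (a : ℤ) (g : ℕ) (b : ℤ) (L : ℕ) (s : ℤ) :
    (((trgEnclN u a g b L s).1 : ℕ) : ℝ) ≤ 10 ^ 15 * trgGVal u a g b L s ∧
      (10 : ℝ) ^ 15 * trgGVal u a g b L s ≤ (((trgEnclN u a g b L s).2 : ℕ) : ℝ) := by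
  obtain ⟨⟨hm1, hm2⟩, hm0⟩ := trgGVal_mem u a g b L s
  set m := trgGEncl u a g b L s with hm
  have hm12 : m.1 ≤ m.2 := by
    have : (m.1 : ℝ) ≤ m.2 := hm1.trans hm2
    exact_mod_cast this
  have hf0 : 0 ≤ ⌊m.1 * 10 ^ 15⌋ := Int.floor_nonneg.mpr (by positivity)
  have hc0 : 0 ≤ ⌈m.2 * 10 ^ 15⌉ := by
    have : (0 : ℚ) ≤ m.2 * 10 ^ 15 := by nlinarith
    exact Int.ceil_nonneg this
  have e1 : ((⌊m.1 * 10 ^ 15⌋ : ℤ) : ℚ) ≤ m.1 * 10 ^ 15 := Int.floor_le _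
  have e2 : m.2 * 10 ^ 15 ≤ ((⌈m.2 * 10 ^ 15⌉ : ℤ) : ℚ) := Int.le_ceil _
  have e1' : (((⌊m.1 * 10 ^ 15⌋ : ℤ) : ℚ) : ℝ) ≤ ((m.1 * 10 ^ 15 : ℚ) : ℝ) := Rat.cast_le.mpr e1
  have e2' : ((m.2 * 10 ^ 15 : ℚ) : ℝ) ≤ (((⌈m.2 * 10 ^ 15⌉ : ℤ) : ℚ) : ℝ) := Rat.cast_le.mpr e2
  push_cast at e1' e2'
  have c1 : (((⌊m.1 * 10 ^ 15⌋).toNat : ℕ) : ℝ) = ((⌊m.1 * 10 ^ 15⌋ : ℤ) : ℝ) := by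
    have h := Int.toNat_of_nonneg hf0
    exact_mod_cast h
  have c2 : (((⌈m.2 * 10 ^ 15⌉).toNat : ℕ) : ℝ) = ((⌈m.2 * 10 ^ 15⌉ : ℤ) : ℝ) := by
    have h := Int.toNat_of_nonneg hc0
    exact_mod_cast h
  simp only [trgEnclN]
  rw [c1, c2]
  constructor <;> nlinarith

/-- Window candidates of one monomial with enclosure `M` (numerators over `10¹⁵`), as enclosures of
`trgU · value`: `q` in the range of the segment (`1 ≤ p ≤ 32`), `p ∈ [1, 32]` in the range of the scaled
window `[Wlo, Whi]`; all range arithmetic in `ℕ`. [folklore] -/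
def trgWinM (Wlo Whi : ℕ) (M : ℕ × ℕ) : List (ℕ × ℕ) :=
  let qlo : ℕ := max 1 ((M.1 * 2048 + (2855 * 10 ^ 15 - 1)) / (2855 * 10 ^ 15))
  let qhi : ℕ := min 32 (M.2 * 2048 / (81 * 10 ^ 15))
  (List.range' qlo (qhi + 1 - qlo)).flatMap fun q : ℕ =>
    let plo : ℕ := max 1 ((Wlo + (M.2 * (lcm32 / q) - 1)) / (M.2 * (lcm32 / q)))
    let phi : ℕ := min 32 (Whi / (M.1 * (lcm32 / q)))
    (List.range' plo (phi + 1 - plo)).map fun p : ℕ => (p * (M.1 * (lcm32 / q)), p * (M.2 * (lcm32 / q)))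

/-- All window candidates of `TRG` (the fifteen `Γ`-classes `trgGBList`, `u ≤ 2`, `a ∈ [−6, 6]`, the eleven
`(L, s)` classes `trgLSList` of the §7.3 census machine; the empty exponent triple skipped). [folklore] -/
def trgWin (Wlo Whi : ℕ) : List (ℕ × ℕ) :=
  trgGBList.flatMap fun gb => (List.range 3).flatMap fun u => (iccList (-6) 6).flatMap fun a =>
    trgLSList.flatMap fun Ls =>
      if a = 0 ∧ gb.2 = 0 ∧ Ls.2 = 0 then [] else trgWinM Wlo Whi (trgEnclN u a gb.1 gb.2 Ls.1 Ls.2)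

/-- **Soundness of the `TRG` generator**: every generated enclosure contains `trgU · v` for a member `v` of
`trgFullFamily 17 32`. [folklore] -/
theorem trgWin_sound {Wlo Whi : ℕ} {e : ℕ × ℕ} (he : e ∈ trgWin Wlo Whi) :
    ∃ w : ℝ, (∃ v : ℝ, v ∈ trgFullFamily 17 32 ∧ w = (trgU : ℝ) * v) ∧
      ((e.1 : ℕ) : ℝ) ≤ w ∧ w ≤ ((e.2 : ℕ) : ℝ) := by
  unfold trgWin at he
  simp only [List.mem_flatMap, List.mem_range, mem_iccList] at he
  obtain ⟨⟨g, b⟩, hgb, u, hu, a, ha, ⟨L, s⟩, hLs, he⟩ := he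
  obtain ⟨hg, hb1, hb2, -⟩ := mem_trgGBList_iff.mp hgb
  obtain ⟨hL, hs1, hs2, -⟩ := mem_trgLSList_iff.mp hLs
  simp only at he
  split_ifs at he with h0
  · simp at he
  unfold trgWinM at he
  simp only [List.mem_flatMap, List.mem_range'_1, List.mem_map] at he
  obtain ⟨q, hq, p, hp, rfl⟩ := he
  set M := trgEnclN u a g b L s with hM
  have hq1 : 1 ≤ q := le_trans (Nat.le_max_left _ _) hq.1
  have hq32 : q ≤ 32 := by
    have h32 : min 32 (M.2 * 2048 / (81 * 10 ^ 15)) ≤ 32 := Nat.min_le_left _ _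
    omega
  have hp1 : 1 ≤ p := le_trans (Nat.le_max_left _ _) hp.1
  have hp32 : p ≤ 32 := by
    have h32 : min 32 (Whi / (M.1 * (lcm32 / q))) ≤ 32 := Nat.min_le_left _ _
    omega
  obtain ⟨hM1, hM2⟩ := trgEnclN_sound u a g b L s
  rw [← hM] at hM1 hM2
  set f : ℕ := lcm32 / q with hf
  have hfq : f * q = lcm32 := Nat.div_mul_cancel (dvd_lcm32 hq1 hq32)
  have hfq' : (f : ℝ) * (q : ℝ) = 144403552893600 := by
    have h := hfq; unfold lcm32 at h; exact_mod_cast h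
  have hq0 : (0 : ℝ) < q := by exact_mod_cast hq1
  have hf0 : (0 : ℝ) ≤ f := by positivity
  have hp0 : (0 : ℝ) ≤ p := by positivity
  have hmem : (p : ℝ) / q * trgGVal u a g b L s ∈ trgFullFamily 17 32 := by
    refine ⟨p, q, u, L, g, a, b, s, hp1, hp32, hq1, hq32, by omega, hL, hg, ha.1, ha.2, hb1, hb2, hs1, hs2,
      by omega, ?_, rfl⟩
    have h1 : a.natAbs ≤ 6 := by omega
    have h2 : b.natAbs ≤ 4 := by omega
    have h3 : s.natAbs ≤ 1 := by omega
    split_ifs <;> omega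
  have key : (trgU : ℝ) * ((p : ℝ) / q * trgGVal u a g b L s) =
      (p : ℝ) * (f : ℝ) * ((10 : ℝ) ^ 15 * trgGVal u a g b L s) := by
    have e : (trgU : ℝ) = (10 : ℝ) ^ 15 * ((f : ℝ) * (q : ℝ)) := by
      rw [hfq']; unfold trgU lcm32; push_cast; ring
    calc (trgU : ℝ) * ((p : ℝ) / q * trgGVal u a g b L s)
        = (10 : ℝ) ^ 15 * ((f : ℝ) * (q : ℝ)) * ((p : ℝ) / q * trgGVal u a g b L s) := by rw [e]
      _ = (p : ℝ) * (f : ℝ) * ((10 : ℝ) ^ 15 * trgGVal u a g b L s) * ((q : ℝ) / (q : ℝ)) := by ring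
      _ = (p : ℝ) * (f : ℝ) * ((10 : ℝ) ^ 15 * trgGVal u a g b L s) := by rw [div_self hq0.ne', mul_one]
  refine ⟨(trgU : ℝ) * ((p : ℝ) / q * trgGVal u a g b L s), ⟨_, hmem, rfl⟩, ?_, ?_⟩
  · rw [key]; push_cast
    nlinarith [mul_le_mul_of_nonneg_left hM1 (mul_nonneg hp0 hf0)]
  · rw [key]; push_cast
    nlinarith [mul_le_mul_of_nonneg_left hM2 (mul_nonneg hp0 hf0)]

/-- The covering check of one `TRG` window `(x, hi − g]`. [folklore] -/
def trgCover (g x hi : ℕ) : Bool := zgapsLE g x (msortN (trgWin x hi)) hi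

/-- What a passed `TRG` window check means (one `PartsOK` link). [folklore] -/
theorem trgCover_part {g x x' : ℕ} (h : trgCover g x (x' + g) = true) :
    ∃ L : List (ℕ × ℕ), zgapsLE g x L (x' + g) = true ∧
      ∀ e ∈ L, ∃ w : ℝ, (∃ v : ℝ, v ∈ trgFullFamily 17 32 ∧ w = (trgU : ℝ) * v) ∧
        ((e.1 : ℕ) : ℝ) ≤ w ∧ w ≤ ((e.2 : ℕ) : ℝ) :=
  ⟨_, h, fun _ he => trgWin_sound (mem_of_mem_msortN he)⟩

/-- The gap constant of part VIII in units of `trgU`: the certified upper bound `y.hi − x.lo` of the widest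
hole (`4882392437583952229796000 / trgU = 3.38107500802…·10⁻⁵`). [folklore] -/
def trgG : ℕ := 4882392437583952229796000

/-- The hole window of part VIII: `[1.319644018, 1.31967783]`. [folklore] -/
def trgHoleA : ℚ := 1319644018 / 10 ^ 9

/-- See `trgHoleA`. [folklore] -/
def trgHoleB : ℚ := 131967783 / 10 ^ 8

/-- The left bounding tuple of the widest `TRG` hole: `x = (22/21)·π²·Γ(⅓)⁻²·G`
(`(p, q, u, a, g, b, L, s) = (22, 21, 0, 4, 1, −2, 4, 1)`). [folklore] -/
def trgHoleX : TrgTuple := (22, 21, 0, 4, 1, -2, 4, 1)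

/-- The right bounding tuple of the widest `TRG` hole: `y = (5/6)·√3·π^{−5/2}·Γ(⅓)³·ζ(3)⁻¹`
(`(5, 6, 2, −5, 1, 3, 2, −1)`). [folklore] -/
def trgHoleY : TrgTuple := (5, 6, 2, -5, 1, 3, 2, -1)

end ColumnFaceL11
end Summit.CriticalPhenomena.Ising3D
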